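import Literature.AnabelianGeometry.EtaleTheta.TemperedFrobenioidOfGaloisCoveringRankOnePointR
import Literature.AnabelianGeometry.EtaleTheta.Discharge.Sec3Thm37OfInputsCosetWeak
import Literature.AlgebraicGeometry.Frobenioids.ModelFrobenioidPhiBirat
import HarnessLib

/-!
# [EtTh] Theorem 3.7 (i)–(iv), `Λ = ℝ`, END-KNIT AT THE CONSTRUCTED DATA: the rank-one-point tempered Frobenioids
# `ofRankOnePointR` (Tate tower / one-component twin) — every `C`-level binder DISCHARGED, incl. print's rationality

S. Mochizuki, *The étale theta function …*, Publ. RIMS **45** (2009) [EtTh], Thm. 3.7 (i)–(iv) PDF pp. 79–80; Prop. 3.4 (ii) p. 74;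
[FrdI] Def. 4.5 (ii) p. 86 [cite: MochizukiEtTh2009, Thm 3.7 p.79].  abc-iut cell, layer L2, ROWS #31 R388 «THM 3.7 Λ = ℝ END-KNIT
at the constructed data» (abc-iut-L2-lead gen 4); seat abc-iut-w6-d061 (gen 4).  PROOF-ONLY companion of abc-iut-w6-d048's
`TemperedFrobenioidOfGaloisCoveringRankOnePointR.lean` (p447026: `TemperedFrobenioid.ofRankOnePointR hZ P hpf R S` over
`ofRlfRWeak (ofGaloisActionConnected A hZ) hpf`, instances `TateTowerFrd.temperedFrobenioidR`, `OneCompFrd.temperedFrobenioidR`)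
and of abc-iut-w5-d164's WEAK `Λ = ℝ` end knit `TemperedFrobenioid.thm37_ofRlfRWeak_of_inputs_of_cosetCnst`
(`Sec3Thm37OfInputsCosetWeak.lean`; residual binders {`hBmon`, `hD`, `hnd`, `hrat`, `h₀`, `hE`, `hcyc`}).

AT THE CONSTRUCTED DATA (base `{pt} ↦ S₀`, `Φ := im(Φ₀(S₀)^pf → Φ₀(S₀)^rlf)`, `Φ₀(S₀) ≅ ℤ_{≥0}`): the four `C`-LEVEL binders are
THEOREMS — `hBmon` (one-object base), `hD` (`Discrete PUnit` is of FSMFF-type), `hnd` (pull-backs along identities), and print's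
rationality **`hrat`** ([FrdI] Def. 4.5 (ii): every object STRICTLY RATIONAL — for a prime `𝔭` of `Φ` pick a primary `a₀ ∈ 𝔭`,
`a₀^n = ι(m)`, and the CONSTANT function `b_m` with `div₀ b_m = m` (`RankOnePoint.hcnst`): the pair `(ι(div₀ b_m), [a₀^n])` is a
rational function with divisor `[a₀^n] − [1]`, `𝔭 ∈ Supp(a₀^n)`, `𝔭 ∉ Supp(1)`).  The three `D₀`-LEVEL clauses of Prop. 3.4 (ii)
stay NAMED binders, honestly: `h₀ : Prop34Cnst₀ cnst` (naturality in `D^cnst`), `hE` (clause 1 at `Λ = ℝ` over ALL connected coverings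
`Y`, GAP G-w5d130-1), `hcyc` (divisors of constants are integer powers of one log-divisor).  RESULT:
`thm37_ofRankOnePointR_of_inputs (h₀) (hE) (hcyc)` — Thm. 3.7 (i) unit-trivial/isotropic/model/birat-Frobenius-normalized/
sub-quasi-Frobenius-trivial/not group-like ∧ (ii) standard ∧ rationally standard ∧ (iii) first clause ∧ (iv); and the same at
`TateTowerFrd.temperedFrobenioidR` / `OneCompFrd.temperedFrobenioidR` by `rfl`-instantiation (they ARE `ofRankOnePointR`).
HONEST LABEL: the constructed data are the degenerate one-point-base models of record; nothing here bears on [IUTchIII] Cor. 3.12;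
no side taken; typed ≠ proved for the three `D₀`-clauses.
-/

noncomputable section

namespace Literature.AnabelianGeometry.EtaleTheta

open CategoryTheory Opposite Function Literature.AlgebraicGeometry.Frobenioids
  Literature.AnabelianGeometry.SemiGraphs LogDivisorModel LogDivisorModel.GaloisAction

namespace TemperedFrobenioid

variable {Z : LogDivisorModel.{0}} {G : Type} [Group G] {A : Z.GaloisAction G} (hZ : Z.CuspLaws) (P : RankOnePoint A)
  (hpf : ∀ Y : ((isConnectedGSet (G := G)).FullSubcategory)ᵒᵖ,
    IsPerfFactorialCof ((DivisorMonoids.ofGaloisActionConnected A hZ).Φ₀.obj Y))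
  (R S : ((Discrete PUnit.{1})ᵒᵖ ⥤ CommMonCat.{0}) → Prop)

/-! ### The `C`-level binders at `ofRankOnePointR` -/

/-- `hBmon`: `B` is a monoid on the one-object base. [cite: MochizukiFrdI2008, Thm. 5.2 p.100] -/
theorem isMonoidOn_ratFnFunctor_ofRankOnePointR : IsMonoidOn (ofRankOnePointR hZ P hpf R S).ratFnFunctor :=
  Cor38Toy.isMonoidOn_of_punit _

/-- `hnd`: `Φ` is non-dilating (only identity endomorphisms of the base). [cite: MochizukiEtTh2009, Thm 3.7 (ii) p.79] -/
theorem isNonDilatingOn_ofRankOnePointR : IsNonDilatingOn (ofRankOnePointR hZ P hpf R S).divisorMonoid := by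
  rw [(ofRankOnePointR hZ P hpf R S).isNonDilatingOn_divisorMonoid_iff]
  intro X f
  have hf : f = 𝟙 X := Quiver.Hom.unop_inj (Subsingleton.elim _ _)
  subst hf
  have hpull : (ofRankOnePointR hZ P hpf R S).Φ.pull (𝟙 X) = MonoidHom.id _ := by
    ext x
    rw [SubMonoidOn.coe_pull, CategoryTheory.Functor.map_id, MonoidHom.id_apply]
    rfl
  rw [hpull]
  exact Example39NV.isNonDilating_id

/-- `B` is group-like. [cite: MochizukiFrdI2008, Thm. 5.2 p.100] -/
theorem isGroupLike_ratFnFunctor_ofRankOnePointR :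
    Objectwise (fun M _ => IsGroupLike M) (ofRankOnePointR hZ P hpf R S).ratFnFunctor :=
  (ofRankOnePointR hZ P hpf R S).isGroupLike_ratFnFunctor (RankOnePoint.TR hZ hpf).isUnit_BΛ

/-- `Φ` is objectwise divisorial. [cite: MochizukiFrdI2008, Def. 1.1 p.19] -/
theorem isDivisorial_divisorMonoid_ofRankOnePointR :
    Objectwise (fun M _ => IsDivisorial M) (ofRankOnePointR hZ P hpf R S).divisorMonoid :=
  fun _ => PfImageWeak.isDivisorial_mrange_toRealification (hpf (op P.S₀))

/-! ### `hrat`: every object is strictly rational ([FrdI] Def. 4.5 (ii)) — via the constant functions of `RankOnePoint.hcnst` -/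

/-- **The rational function attached to `m ∈ Φ₀(S₀)`**: the pair `(ι(div₀ b_m), [ι(m)])` of `B(pt) = B₀^ℝ|_D ×_{(Φ^{ℝ-log})^gp} Φ^gp`
(`b_m` the constant function with `div₀ b_m = m`). [cite: MochizukiEtTh2009, Def 3.6 p.77] -/
def ratFnOfPhi (X : (Discrete PUnit.{1})ᵒᵖ) (m : A.phiZero P.S₀.obj) : ↥((ofRankOnePointR hZ P hpf R S).ratFn X) :=
  ⟨(P.cnstFnR hZ hpf m,
    Algebra.GrothendieckGroup.of (⟨(hpf (op P.S₀)).weak.toRealification (Perfection.of _ m), ⟨_, rfl⟩⟩ :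
      ↥((ofRankOnePointR hZ P hpf R S).Φ.carrier X))), by
    change (RankOnePoint.TR hZ hpf).divΛ (op P.S₀) (P.cnstFnR hZ hpf m) =
      EtaleTheta.gpMap ((ofRankOnePointR hZ P hpf R S).Φ.carrier X).subtype (Algebra.GrothendieckGroup.of _)
    rw [RankOnePoint.divΛ_cnstFnR, EtaleTheta.gpMap_of, EtaleTheta.gpMap_of]
    rfl⟩

/-- **`hrat`, strictly: every object of `ofRankOnePointR` is STRICTLY RATIONAL** w.r.t. THE birationalization and the primary support:
for a prime `𝔭` of `Φ(pt)` and a primary `a₀ ∈ 𝔭` with `a₀^n = ι(m)`, the rational function of `m` has divisor `[a₀^n] − [1]`,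
`𝔭 ∈ Supp(a₀^n)`, `𝔭 ∉ Supp(1)`. [cite: MochizukiFrdI2008, Def. 4.5 (ii) p.86] -/
theorem isStrictlyRational_ofRankOnePointR (X : (ofRankOnePointR hZ P hpf R S).category) :
    PreFrobenioidData.IsStrictlyRational
      (PreFrobenioid.biratData
        ((ofRankOnePointR hZ P hpf R S).isFrobenioid_treeCatVocab_of_isMonoidOn (isMonoidOn_ratFnFunctor_ofRankOnePointR hZ P hpf R S))
        (PreFrobenioid.hasBiratSquares_of_isFrobenioid
          ((ofRankOnePointR hZ P hpf R S).isFrobenioid_treeCatVocab_of_isMonoidOn (isMonoidOn_ratFnFunctor_ofRankOnePointR hZ P hpf R S))))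
      (S := PreFrobenioidData.ofFunctor (ofRankOnePointR hZ P hpf R S).divisorMonoid (ofRankOnePointR hZ P hpf R S).toElem)
      (fun a 𝔭 => PrimarySupp a 𝔭) X := by
  classical
  refine (ModelFrobenioid.isStrictlyRational_biratData_iff (isGroupLike_ratFnFunctor_ofRankOnePointR hZ P hpf R S)
    (isDivisorial_divisorMonoid_ofRankOnePointR hZ P hpf R S) _ _ _ X).mpr fun 𝔭 => ?_
  -- a primary element of `𝔭`, and a power of it in the image of `Φ₀(S₀)`
  induction 𝔭 using Quotient.inductionOn with
  | h a₀p =>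
  obtain ⟨a₀, h₀⟩ := a₀p
  obtain ⟨α, hα⟩ := a₀.2
  obtain ⟨⟨m, n⟩, rfl⟩ := Perfection.mk_surjective α
  dsimp only at hα
  have hα' : (hpf (op P.S₀)).weak.toRealification (Perfection.of _ m) =
      (hpf (op P.S₀)).weak.toRealification (Perfection.mk m n) ^ (n : ℕ) := by
    rw [← map_pow, Perfection.mk_pow_self]
  have hpow : a₀ ^ (n : ℕ) =
      (⟨(hpf (op P.S₀)).weak.toRealification (Perfection.of _ m), ⟨_, rfl⟩⟩ : ↥((ofRankOnePointR hZ P hpf R S).Φ.carrier (op X.base))) := by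
    apply Subtype.ext
    have h1 : Subtype.val (a₀ ^ (n : ℕ)) = (Subtype.val a₀) ^ (n : ℕ) := rfl
    rw [h1]
    show (Subtype.val a₀) ^ (n : ℕ) = (hpf (op P.S₀)).weak.toRealification (Perfection.of _ m)
    rw [hα']
    exact congrArg (fun t => t ^ (n : ℕ)) hα.symm
  refine ⟨a₀ ^ (n : ℕ), 1, ⟨ratFnOfPhi hZ P hpf R S (op X.base) m, ?_⟩,
    ⟨a₀, h₀, rfl, ⟨1, one_pos, by rw [pow_one]; exact dvd_pow_self a₀ n.ne_zero⟩⟩, ?_⟩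
  · rw [hpow, map_one, div_one]
    rfl
  · rintro ⟨b₀, hb₀, _, ⟨k, _, ⟨c, hc⟩⟩⟩
    have h1 : b₀ * c = 1 := hc.symm.trans (one_pow k)
    exact hb₀.1 ((PfImageWeak.isDivisorial_mrange_toRealification (hpf (op P.S₀))).isSharp.1 _ (isUnit_iff_exists_inv.mpr ⟨c, h1⟩))

/-- **`hrat`: every object of `ofRankOnePointR` is RATIONAL** ([FrdI] Def. 4.5 (ii)). [cite: MochizukiFrdI2008, Def. 4.5 (ii) p.86] -/
theorem isRational_ofRankOnePointR (X : (ofRankOnePointR hZ P hpf R S).category) :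
    PreFrobenioidData.IsRational
      (PreFrobenioid.biratData
        ((ofRankOnePointR hZ P hpf R S).isFrobenioid_treeCatVocab_of_isMonoidOn (isMonoidOn_ratFnFunctor_ofRankOnePointR hZ P hpf R S))
        (PreFrobenioid.hasBiratSquares_of_isFrobenioid
          ((ofRankOnePointR hZ P hpf R S).isFrobenioid_treeCatVocab_of_isMonoidOn (isMonoidOn_ratFnFunctor_ofRankOnePointR hZ P hpf R S))))
      (S := PreFrobenioidData.ofFunctor (ofRankOnePointR hZ P hpf R S).divisorMonoid (ofRankOnePointR hZ P hpf R S).toElem)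
      (fun a 𝔭 => PrimarySupp a 𝔭) X :=
  ModelFrobenioid.isRational_of_isStrictlyRational _ _ _ X (isStrictlyRational_ofRankOnePointR hZ P hpf R S X)

/-! ### The END KNIT at the constructed data -/

/-- **[EtTh] Theorem 3.7 (i)–(iv), `Λ = ℝ`, at the rank-one-point tempered Frobenioid over the CONSTRUCTED connected data**, with
`D^cnst = 𝓑(G_K)⁰` for any compact `G_K` and any `cnst`: the `C`-level binders `hBmon`, `hD`, `hnd`, `hrat` are DISCHARGED; the residual
is exactly the three `D₀`-level clauses of Prop. 3.4 (ii) — `h₀ : Prop34Cnst₀ cnst`, `hE` (clause 1 at `Λ = ℝ`), `hcyc`.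
[cite: MochizukiEtTh2009, Thm 3.7 p.79] -/
theorem thm37_ofRankOnePointR_of_inputs {GK : Type} [Group GK] [TopologicalSpace GK] [SeparatelyContinuousMul GK] [CompactSpace GK]
    (cnst : (isConnectedGSet (G := G)).FullSubcategory ⥤ CosetCat GK)
    (h₀ : (DivisorMonoids.ofGaloisActionConnected A hZ).Prop34Cnst₀ cnst)
    (hE : ∀ (Y : (isConnectedGSet (G := G)).FullSubcategory)
      (b : Algebra.GrothendieckGroup ((RealifiedDivisorMonoids.realDataWeak (DivisorMonoids.ofGaloisActionConnected A hZ) hpf).rlf.obj (op Y)))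
      (x : (hpf (op Y)).weak.Rlf),
      b ∈ ((RealifiedDivisorMonoids.realDataWeak (DivisorMonoids.ofGaloisActionConnected A hZ) hpf).realSpan
          (DivisorMonoids.ofGaloisActionConnected A hZ).biratGp).carrier Y →
        b = Algebra.GrothendieckGroup.of x →
        b ∈ ((RealifiedDivisorMonoids.realDataWeak (DivisorMonoids.ofGaloisActionConnected A hZ) hpf).realSpan
          (DivisorMonoids.ofGaloisActionConnected A hZ).cnstGp).carrier Y)
    (hcyc : ∀ Y : ((isConnectedGSet (G := G)).FullSubcategory)ᵒᵖ, ∃ d : (DivisorMonoids.ofGaloisActionConnected A hZ).Φ₀.obj Y,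
      ∀ b ∈ (DivisorMonoids.ofGaloisActionConnected A hZ).F₀ Y, ∃ n : ℤ,
        (DivisorMonoids.ofGaloisActionConnected A hZ).div₀ Y b = Algebra.GrothendieckGroup.of d ^ n) :
    (PreFrobenioid.IsOfType (PreFrobenioid.IsUnitTrivial (ofRankOnePointR hZ P hpf R S).toElem) ∧
      PreFrobenioid.IsOfIsotropicType (ofRankOnePointR hZ P hpf R S).toElem ∧
      PreFrobenioid.IsOfModelType (ofRankOnePointR hZ P hpf R S).toElem
        ((ofRankOnePointR hZ P hpf R S).isFrobenioid_treeCatVocab_of_isMonoidOn (isMonoidOn_ratFnFunctor_ofRankOnePointR hZ P hpf R S))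
        (PreFrobenioid.hasBiratSquares_of_isFrobenioid
          ((ofRankOnePointR hZ P hpf R S).isFrobenioid_treeCatVocab_of_isMonoidOn (isMonoidOn_ratFnFunctor_ofRankOnePointR hZ P hpf R S))) ∧
      PreFrobenioidData.IsOfBiratFrobeniusNormalizedType
        (PreFrobenioid.biratData
          ((ofRankOnePointR hZ P hpf R S).isFrobenioid_treeCatVocab_of_isMonoidOn (isMonoidOn_ratFnFunctor_ofRankOnePointR hZ P hpf R S))
          (PreFrobenioid.hasBiratSquares_of_isFrobenioid
            ((ofRankOnePointR hZ P hpf R S).isFrobenioid_treeCatVocab_of_isMonoidOn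
              (isMonoidOn_ratFnFunctor_ofRankOnePointR hZ P hpf R S)))) ∧
      PreFrobenioid.IsOfType (PreFrobenioid.IsSubQuasiFrobeniusTrivial (ofRankOnePointR hZ P hpf R S).toElem) ∧
      ¬ PreFrobenioid.IsOfType (PreFrobenioid.IsGroupLikeObj (ofRankOnePointR hZ P hpf R S).toElem)) ∧
    ((ModelFrobenioid.data (ofRankOnePointR hZ P hpf R S).divisorMonoid (ofRankOnePointR hZ P hpf R S).ratFnFunctor
        (ofRankOnePointR hZ P hpf R S).divBNatTrans).IsOfStandardType ∧
      (PreFrobenioidData.ofFunctor (ofRankOnePointR hZ P hpf R S).divisorMonoid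
          (ofRankOnePointR hZ P hpf R S).toElem).IsOfRationallyStandardType
        (PreFrobenioid.rsParams
          ((ofRankOnePointR hZ P hpf R S).isFrobenioid_treeCatVocab_of_isMonoidOn (isMonoidOn_ratFnFunctor_ofRankOnePointR hZ P hpf R S))
          fun a 𝔭 => PrimarySupp a 𝔭)) ∧
    (∀ X : (ofRankOnePointR hZ P hpf R S).category,
      FrobenioidFacade.AutActionFactorsThrough ((ofRankOnePointR hZ P hpf R S).base ⋙ cnst) (ofRankOnePointR hZ P hpf R S).toElem X) ∧
    (ofRankOnePointR hZ P hpf R S).Thm37_iv :=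
  (ofRankOnePointR hZ P hpf R S).thm37_ofRlfRWeak_of_inputs_of_cosetCnst (cnst := cnst)
    (isMonoidOn_ratFnFunctor_ofRankOnePointR hZ P hpf R S) PadicFrd.isOfFSMType_discretePUnit.isOfFSMFFType
    (isNonDilatingOn_ofRankOnePointR hZ P hpf R S) (isRational_ofRankOnePointR hZ P hpf R S) h₀ hE hcyc

end TemperedFrobenioid

end Literature.AnabelianGeometry.EtaleTheta

end
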